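import Summits.QuantumFields.YangMills.Theorems.BalabanUVNodesPortS1Functional
import Summits.QuantumFields.YangMills.Theorems.BalabanUVNodesPortS1LogHalf
import Summits.QuantumFields.YangMills.Theorems.BalabanUVNodesK0RecordFormatNamesIntLocalW

/-!
# NODE O port PT-A — THE SPLIT's GERM FROM A COARSE-FIELD NEIGHBOURHOOD, `ResidueAtW` MONOTONE IN ITS CONSTANTS, and the per-cube ⟹ (1.18) passage in the WRAP-AWARE currency
# (the three small adapters the S2-A ∕ LZ ∕ FE suppliers meet first)

Cell `ym-nodeO-ideate`, porter seat `ymgap-nodeO-port-PTA-1` (gen 3); `--supports stmt-QuantumFields-27930` (helper).  [I] = [Balaban1987RG1], [II] = [Balaban1988RG2Cluster].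
* §1 ★ `split_germ_of_coarseNhds` — S2-A's natural output is COARSE-FIELD-LEVEL: «for `W` in a neighbourhood of `1` (level `k+1` fields), `𝓝_{k+1}(W) = Z(W) + E(W)`» ([I] (2.12) on the small-field
  domain); the SPLIT consumed by `…ResidueWAdd.sig27930v8LR4_of_residueAtW₂` is its GERM IN THE CHART VARIABLE `B` at `0`: compose with `W_B = unitField B` (continuous, `W_0 = 1` —
  `…PortS1Selector.continuous_unitField_thetaFill`, `unitField_zero`) and `…PortS1Functional.recordΦfAx_eq_mergedTermT_unitField`.
* §2 `residueAtW_mono` — (b)-constants monotone: larger `E₀`, smaller `κ` (`d_{k+1}(X) ≥ 0`) — the LZ half (`κ = r − 1`) and the FE half ([II]'s κ) meet at `min`.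
* §3 `bound118OnUcOff_of_logHalfBound`, `bound118OnW_of_logHalfBound` — the per-cube `B13.LogHalfBound` shape at every volume with volume-uniform `(B, r)` gives the off-wrap ∕ on-wrap
  (b) rows with `E₀ = B·4·2⁴`, `κ = r − 1` (`…PortS1LogHalf` in the wrap-aware currency).

HONEST FRAMING.  Plumbing; NOTHING of Bałaban's (2.12) is asserted — the coarse-level split is a HYPOTHESIS of §1; the residue is NOT proved; 27930 OPEN; K0⁷ NOT closed; NODE O 0∕1;
COUNT 8∕28 · K 1∕4 UNMOVED; finite `𝕋⁴_{L^K}` at fixed ε — NOT continuum ∕ OS ∕ Clay; **the Yang–Mills mass gap is NOT proved by any of this.**  No `sorry`, no `def`, no `instance`.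
-/

noncomputable section

open scoped BigOperators Matrix.Norms.L2Operator Topology

namespace Summit.QuantumFields.YangMills.Theorems.BalabanUVNodesPortS1

open Summit.QuantumFields.YangMills.Theorems.K0RecordFormatNames
open Literature.MathematicalPhysics.QuantumFieldTheory.Balaban1983to89
open Literature.MathematicalPhysics.QuantumFieldTheory.Balaban1983to89.Node00
open Literature.MathematicalPhysics.QuantumFieldTheory.Balaban1983to89.T4Continuum (T4Family)
open Literature.MathematicalPhysics.QuantumFieldTheory.Balaban1983to89.TreeLengthTorus (tvolumeLeaf tcubeSys_vol)
open _root_.Filter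

variable (F : T4Family)

/-! ## §1  ★ The SPLIT's germ at `B = 0` from a coarse-field-level identity near `W = 1` -/

/-- ★ **THE SPLIT's GERM FROM A COARSE-FIELD NEIGHBOURHOOD.**  If at every volume there is a neighbourhood `𝒩 ∈ 𝓝 1` of the unit level-`(k+1)` field on which the merged term of
record splits as `𝓝_{k+1}(v; W) = Z n W + E n W` (S2-A's (2.12) at the record — a HYPOTHESIS here), then the functional of the signed text splits in the chart variable:
`recordΦfAx … B = Z n (W_B) + E n (W_B)` eventually at `B = 0` — the `Φ₁ + Φ₂` conjunct of `sig27930v8LR4_of_residueAtW₂` with `Φ₁ := Z n ∘ unitField`, `Φ₂ := E n ∘ unitField`.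
[cite: Balaban1987RG1, (2.12) p.268, (1.6) p.261, p.264 (before (1.20))] -/
theorem split_germ_of_coarseNhds (a₀ ε₂₉ : ℝ) (Mc k : ℕ) (v : Fin (k + 1) → ℝ)
    (Z E : (n : ℕ) → GaugeField (F.P (recordK₀ F Mc k + n)) (k + 1) (SU 2) → ℝ)
    (hsplit : ∀ n, ∃ 𝒩 ∈ 𝓝 (1 : GaugeField (F.P (recordK₀ F Mc k + n)) (k + 1) (SU 2)), ∀ W ∈ 𝒩,
      letI θ := thetaFill F a₀ ε₂₉; letI := θ.instVβ₁; letI := θ.instVβ₂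
      mergedTermT F 2 (TβOfRecord₁₃ F 2) (chiβOfRecord₁₃Ax F 2 θ) θ.εbg (recordK₀ F Mc k + n) (T4FlagMemory.extd v) k W = Z n W + E n W) (n : ℕ) :
    letI θ := thetaFill F a₀ ε₂₉; letI := θ.instVβ₁; letI := θ.instVβ₂; letI := θ.instιβ
    ∀ᶠ B in 𝓝 (0 : recordW F a₀ ε₂₉ k (recordK₀ F Mc k + n)),
      recordΦfAx F a₀ ε₂₉ k v (recordK₀ F Mc k + n) B =
        ((Z n (unitField F θ k (recordK₀ F Mc k + n) B) : ℂ) + (E n (unitField F θ k (recordK₀ F Mc k + n) B) : ℂ)) := by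
  letI θ := thetaFill F a₀ ε₂₉; letI := θ.instVβ₁; letI := θ.instVβ₂; letI := θ.instιβ
  obtain ⟨𝒩, h𝒩, hZE⟩ := hsplit n
  have hc := (continuous_unitField_thetaFill F a₀ ε₂₉ k (recordK₀ F Mc k + n)).continuousAt (x := (0 : recordW F a₀ ε₂₉ k (recordK₀ F Mc k + n)))
  have h0 : unitField F θ k (recordK₀ F Mc k + n) (0 : recordW F a₀ ε₂₉ k (recordK₀ F Mc k + n)) = 1 := unitField_zero F θ k _
  have hev : ∀ᶠ B in 𝓝 (0 : recordW F a₀ ε₂₉ k (recordK₀ F Mc k + n)), unitField F θ k (recordK₀ F Mc k + n) B ∈ 𝒩 := by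
    refine hc.preimage_mem_nhds ?_
    rw [h0]
    exact h𝒩
  filter_upwards [hev] with B hB
  rw [recordΦfAx_eq_mergedTermT_unitField, hZE _ hB]
  push_cast
  rfl

/-! ## §2  `ResidueAtW` is monotone in its (b)-constants -/

variable {F} in
/-- **Monotonicity of the wrap-aware residue in `(E₀, κ)`**: a larger `E₀' ≥ E₀ ≥ 0`-compatible constant and a smaller rate `κ' ≤ κ` still bound (both halves of (b); the other rows
are untouched). [cite: Balaban1987RG1, (1.18) p.263 (bookkeeping)] -/
theorem residueAtW_mono {Mc k : ℕ} {Ψ : IntLocalFormula (F.L ^ (k + 1) * Mc)} {Ew : TorusPieces F Mc k} {a₀ ε₂₉ α₀ α₁ E₀ E₀' κ κ' : ℝ}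
    {Φf : (n : ℕ) → recordW F a₀ ε₂₉ k (recordK₀ F Mc k + n) → ℂ}
    (h : Ψ.ResidueAtW F Mc k Ew a₀ ε₂₉ α₀ α₁ E₀ κ Φf) (hE : E₀ ≤ E₀') (hκ : κ' ≤ κ) (hE₀' : 0 ≤ E₀') :
    Ψ.ResidueAtW F Mc k Ew a₀ ε₂₉ α₀ α₁ E₀' κ' Φf := by
  have key : ∀ (n : ℕ) (X : (recordDomSys F Mc k (recordK₀ F Mc k + n)).Dom) (t : ℝ),
      t ≤ E₀ * Real.exp (-κ * (recordDomSys F Mc k (recordK₀ F Mc k + n)).dj X) →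
        t ≤ E₀' * Real.exp (-κ' * (recordDomSys F Mc k (recordK₀ F Mc k + n)).dj X) := by
    intro n X t ht
    have hd : 0 ≤ (recordDomSys F Mc k (recordK₀ F Mc k + n)).dj X := (recordDomSys F Mc k (recordK₀ F Mc k + n)).dj_nonneg X
    have hexp : Real.exp (-κ * (recordDomSys F Mc k (recordK₀ F Mc k + n)).dj X) ≤ Real.exp (-κ' * (recordDomSys F Mc k (recordK₀ F Mc k + n)).dj X) :=
      Real.exp_le_exp.mpr (mul_le_mul_of_nonneg_right (neg_le_neg hκ) hd)
    exact ht.trans ((mul_le_mul_of_nonneg_right hE (Real.exp_pos _).le).trans (mul_le_mul_of_nonneg_left hexp hE₀'))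
  obtain ⟨hA, hB, hEA, hEB, hEL, hEG, hR⟩ := h
  exact ⟨hA, fun n X hX φ hφ => key n X _ (hB n X hX φ hφ), hEA, fun n X hX φ hφ => key n X _ (hEB n X hX φ hφ), hEL, hEG, hR⟩

/-! ## §3  Per-cube bounds ⟹ the off-wrap ∕ on-wrap (b) rows -/

/-- **Off-wrap (b) from per-cube bounds**: `B13.LogHalfBound` for the pull-back pieces at every volume (uniform `B ≥ 0`, `r`) ⟹ `Bound118OnUcOff … (B·4·2⁴) (r − 1)`.
[cite: Balaban1988RG2Cluster, p.21 (closing paragraph), (2.30) p.18; Balaban1987RG1, (1.18) p.263] -/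
theorem bound118OnUcOff_of_logHalfBound (Ψ : IntFormula) (Mc k : ℕ) (α₀ α₁ B r : ℝ) (hB : 0 ≤ B)
    (hlog : ∀ n, B13.LogHalfBound (recordDomSys F Mc k (recordK₀ F Mc k + n))
        (fun X => {φ : Sect2.CPair (F.P (recordK₀ F Mc k + n)) (MatA 2) |
          encodeCfg F (recordK₀ F Mc k + n) φ ∈ recordUc F Mc k α₀ α₁ (recordK₀ F Mc k + n) X})
        (fun X φ => Ψ.piece F Mc k (recordK₀ F Mc k + n) X φ) (fun X => (X.1 : Finset _).card) B r) :
    Ψ.Bound118OnUcOff F Mc k α₀ α₁ (B * (4 * 2 ^ 4)) (r - 1) := by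
  have h := bound118OnUc_of_logHalfBound F Ψ Mc k α₀ α₁ B r hB hlog
  rw [IntFormula.bound118OnUc_iff] at h
  exact fun n X _ φ hφ => h n X φ hφ

/-- **On-wrap (b) from per-cube bounds** for torus pieces: `B13.LogHalfBound` at every volume (uniform `B ≥ 0`, `r`) ⟹ `Bound118OnW … (B·4·2⁴) (r − 1)`.
[cite: Balaban1988RG2Cluster, p.21 (closing paragraph), (2.30) p.18; Balaban1987RG1, (1.18) p.263] -/
theorem bound118OnW_of_logHalfBound {Mc k : ℕ} (Ew : TorusPieces F Mc k) (α₀ α₁ B r : ℝ) (hB : 0 ≤ B)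
    (hlog : ∀ n, B13.LogHalfBound (recordDomSys F Mc k (recordK₀ F Mc k + n))
        (fun X => {φ : Sect2.CPair (F.P (recordK₀ F Mc k + n)) (MatA 2) |
          encodeCfg F (recordK₀ F Mc k + n) φ ∈ recordUc F Mc k α₀ α₁ (recordK₀ F Mc k + n) X})
        (Ew n) (fun X => (X.1 : Finset _).card) B r) :
    Ew.Bound118OnW F α₀ α₁ (B * (4 * 2 ^ 4)) (r - 1) := by
  intro n X _ φ hφ
  have hvol : B13.VolBoundK1 (recordDomSys F Mc k (recordK₀ F Mc k + n)) (fun X => (X.1 : Finset _).card) (4 * 2 ^ 4) := by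
    intro X
    have h := tvolumeLeaf (F.P (recordK₀ F Mc k + n)).d (Sect2.domCount (F.P (recordK₀ F Mc k + n)) Mc (k + 1)) X
    rw [tcubeSys_vol] at h
    exact h
  exact B13.bound118_of_logHalfBound _ _ _ _ hB (hlog n) hvol X φ hφ

end Summit.QuantumFields.YangMills.Theorems.BalabanUVNodesPortS1

end
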